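import Summits.AtomisticToContinuum.BoseEinsteinCondensation.Theses.BECTangentRigidity
import Summits.AtomisticToContinuum.BoseEinsteinCondensation.Theorems.BECTangentRigidityRigidMomentumBoundStubDirichletEnergyLinear
import Summits.AtomisticToContinuum.BoseEinsteinCondensation.Theorems.BECTangentRigidityRigidMomentumBoundStubSmearWeight
import Summits.AtomisticToContinuum.BoseEinsteinCondensation.Theorems.BECTangentRigidityRigidMomentumBoundStubSmearSqCalculus
import Summits.AtomisticToContinuum.BoseEinsteinCondensation.Theorems.BECTangentRigidityRigidMomentumBoundStubSmearStep
import HarnessLib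

/-!
# Crux `RigidMomentumBound` (stmt-AtomisticToContinuum-13034), line `registered`:
# the smearing bound and the reduction of the crux to displacement softness

Supports (does not close) stmt-AtomisticToContinuum-13034. Two unconditional results of the line
`registered` (lead c3), assembled from the landed stubs `stub_smearStep` (rigid smearing step),
`stub_smearSqCalculus`, `stub_smearWeight`, `stub_dirichletEnergyLinear` and König's identity
(`Literature/MathematicalPhysics/QuantumManyBody/CentreOfMassKineticEnergy.lean`):

* `smearingBound` : `E₀(N, L + 6τ) ≤ E₀^rel(N, L) + 3π²/(4Nτ²)` for every measurable pair potential
  (hard cores allowed), every `N`, `L`, `τ > 0` — adding the centre-of-mass kinetic energy to `H_rel`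
  costs at most the zero-point energy of the smearing profile, provided the box is enlarged by `6τ`
  (three smearing steps, one per coordinate direction; rigid shifts preserve all pair distances);
* `rigidMomentumBound_of_displacementSoftness` : the crux `RigidMomentumBound` follows from
  **displacement softness** of the Dirichlet energy, `E₀(N,L_N) ≤ E₀(N,(1+κ/N)L_N) + εN/L_N²` eventually
  in `N` for all `ε, κ > 0` at small density (the registered open stub `stub_displacementSoftness`):
  `⟨Ψ,P²Ψ⟩ ≤ N(E₀ + δ − E₀^rel) ≤ N[E₀(L_N) − E₀((1+κ/N)L_N)] + εN²/(4L²) + Nδ` with `τ = κL_N/(6N)`,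
  `κ² = 108π²/ε`.

References: Lieb–Loss, *Analysis* (2001) Thm 7.8 (convexity for gradients); Cornean–Dereziński–Ziń,
J. Math. Phys. 50 (2009) §2.2 (`H = P²/2nm + H_rel`); LSSY 2005 §5.2 fn 2 (the torus case).
-/

noncomputable section

namespace Summit.AtomisticToContinuum.BoseEinsteinCondensation.Theorems.RigidMomentumBound

open MeasureTheory Filter
open scoped ENNReal NNReal BigOperators
open Literature.MathematicalPhysics.QuantumManyBody.BoseGas

namespace Smearing

/-! ## The smearing bound `E₀(N, L + 6τ) ≤ E₀^rel(N, L) + 3π²/(4Nτ²)` -/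

/-- Three smearing steps (directions `0, 1, 2`, by the landed `stub_smearStep` fed with the landed
`stub_smearSqCalculus` and `stub_smearWeight`): from `Φ` in the box `L₀` to `Θ` in the box
`L₀ + 2τ + 2τ + 2τ` with relative energy `≤ ⟨Φ,H_relΦ⟩ + 3s` and total rigid fluctuation
`∑_b ∫|∑ⱼ∂_{j,b}Θ|² ≤ 3(π²/(4τ²) + s) + 3s`. -/
theorem smear_three (v : ℝ → ℝ≥0∞) (hv : Measurable v) {N : ℕ} {L₀ : ℝ} (Φ : TrialState N L₀)
    (τ s : ℝ) (hτ : 0 < τ) (hs : 0 < s) :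
    ∃ Θ : TrialState N (L₀ + 2 * τ + 2 * τ + 2 * τ),
      relEnergy v Θ ≤ relEnergy v Φ + 3 * ENNReal.ofReal s ∧
      ∑ b : Fin 3, (∫⁻ X, (‖fderiv ℝ Θ.ψ X (fun _ : Fin N => EuclideanSpace.single b (1 : ℝ))‖₊ : ℝ≥0∞) ^ 2)
        ≤ 3 * ENNReal.ofReal (Real.pi ^ 2 / (4 * τ ^ 2) + s) + 3 * ENNReal.ofReal s := by
  obtain ⟨Θ₁, h1r, h1b, h1a⟩ := RigidMomentumBound.stub_smearStep v hv Φ 0 τ s hτ hs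
    (RigidMomentumBound.stub_smearSqCalculus Φ 0 τ hτ) (RigidMomentumBound.stub_smearWeight τ hτ)
  obtain ⟨Θ₂, h2r, h2b, h2a⟩ := RigidMomentumBound.stub_smearStep v hv Θ₁ 1 τ s hτ hs
    (RigidMomentumBound.stub_smearSqCalculus Θ₁ 1 τ hτ) (RigidMomentumBound.stub_smearWeight τ hτ)
  obtain ⟨Θ₃, h3r, h3b, h3a⟩ := RigidMomentumBound.stub_smearStep v hv Θ₂ 2 τ s hτ hs
    (RigidMomentumBound.stub_smearSqCalculus Θ₂ 2 τ hτ) (RigidMomentumBound.stub_smearWeight τ hτ)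
  refine ⟨Θ₃, ?_, ?_⟩
  · calc relEnergy v Θ₃ ≤ relEnergy v Θ₂ + ENNReal.ofReal s := h3r
      _ ≤ relEnergy v Θ₁ + ENNReal.ofReal s + ENNReal.ofReal s := by gcongr
      _ ≤ relEnergy v Φ + ENNReal.ofReal s + ENNReal.ofReal s + ENNReal.ofReal s := by gcongr
      _ = relEnergy v Φ + 3 * ENNReal.ofReal s := by ring
  · set P : ℝ≥0∞ := ENNReal.ofReal (Real.pi ^ 2 / (4 * τ ^ 2) + s) with hP
    set S : ℝ≥0∞ := ENNReal.ofReal s with hS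
    have e0 : (∫⁻ X, (‖fderiv ℝ Θ₃.ψ X (fun _ : Fin N => EuclideanSpace.single 0 (1 : ℝ))‖₊ : ℝ≥0∞) ^ 2)
        ≤ P + S + S :=
      calc (∫⁻ X, (‖fderiv ℝ Θ₃.ψ X (fun _ : Fin N => EuclideanSpace.single 0 (1 : ℝ))‖₊ : ℝ≥0∞) ^ 2)
            ≤ (∫⁻ X, (‖fderiv ℝ Θ₂.ψ X (fun _ : Fin N => EuclideanSpace.single 0 (1 : ℝ))‖₊ : ℝ≥0∞) ^ 2)
              + S := h3b 0
        _ ≤ (∫⁻ X, (‖fderiv ℝ Θ₁.ψ X (fun _ : Fin N => EuclideanSpace.single 0 (1 : ℝ))‖₊ : ℝ≥0∞) ^ 2)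
              + S + S := by gcongr; exact h2b 0
        _ ≤ P + S + S := by gcongr
    have e1 : (∫⁻ X, (‖fderiv ℝ Θ₃.ψ X (fun _ : Fin N => EuclideanSpace.single 1 (1 : ℝ))‖₊ : ℝ≥0∞) ^ 2)
        ≤ P + S :=
      calc (∫⁻ X, (‖fderiv ℝ Θ₃.ψ X (fun _ : Fin N => EuclideanSpace.single 1 (1 : ℝ))‖₊ : ℝ≥0∞) ^ 2)
            ≤ (∫⁻ X, (‖fderiv ℝ Θ₂.ψ X (fun _ : Fin N => EuclideanSpace.single 1 (1 : ℝ))‖₊ : ℝ≥0∞) ^ 2)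
              + S := h3b 1
        _ ≤ P + S := by gcongr
    have e2 : (∫⁻ X, (‖fderiv ℝ Θ₃.ψ X (fun _ : Fin N => EuclideanSpace.single 2 (1 : ℝ))‖₊ : ℝ≥0∞) ^ 2)
        ≤ P := h3a
    calc ∑ b : Fin 3, (∫⁻ X,
            (‖fderiv ℝ Θ₃.ψ X (fun _ : Fin N => EuclideanSpace.single b (1 : ℝ))‖₊ : ℝ≥0∞) ^ 2)
          ≤ (P + S + S) + (P + S) + P := by
            rw [Fin.sum_univ_three]
            exact add_le_add (add_le_add e0 e1) e2
      _ = 3 * P + 3 * S := by ring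

/-- For `N = 0` every energy vanishes. -/
theorem energy_eq_zero_of_zero {L : ℝ} (v : ℝ → ℝ≥0∞) (Θ : TrialState 0 L) : energy v Θ = 0 := by
  simp [energy, kineticDensity, interaction]

/-- **The smearing bound** `E₀(N, L₀ + 6τ) ≤ E₀^rel(N, L₀) + 3π²/(4Nτ²)` for every measurable
`v ≥ 0` (hard cores allowed), every `N`, `L₀` and every `τ > 0` (registered sub-goal `smearingBound` of
the crux item; fully qualified names in the header for the verbatim registration). Proof: for each `Φ` in the box `L₀` with finite
relative energy and each slack, `smear_three` gives `Θ` in the box `L₀ + 6τ` with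
`N⟨Θ,HΘ⟩ = ∑_b∫|∑ⱼ∂_{j,b}Θ|² + N⟨Θ,H_relΘ⟩ ≤ 3π²/(4τ²) + N⟨Φ,H_relΦ⟩ + O(slack)` (König); divide by
`N`, use `E₀ ≤ ⟨Θ,HΘ⟩`, let the slack go to `0` and take the infimum over `Φ`. -/
theorem smearingBound : ∀ (v : ℝ → ENNReal), Measurable v → ∀ (N : ℕ) (L₀ τ : ℝ), 0 < τ → Literature.MathematicalPhysics.QuantumManyBody.BoseGas.groundStateEnergy v N (L₀ + 6 * τ) ≤ Literature.MathematicalPhysics.QuantumManyBody.BoseGas.relGroundStateEnergy v N L₀ + ENNReal.ofReal (3 * Real.pi ^ 2 / (4 * N * τ ^ 2)) := by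
  intro v hv N L₀ τ hτ
  have hL : L₀ + 2 * τ + 2 * τ + 2 * τ = L₀ + 6 * τ := by ring
  rw [← hL, relGroundStateEnergy, ENNReal.iInf_add]
  refine le_iInf fun Φ => ?_
  rcases eq_or_ne (relEnergy v Φ) ⊤ with htop | htop
  · simp [htop]
  rcases Nat.eq_zero_or_pos N with hN | hN
  · subst hN
    obtain ⟨Θ, -, -⟩ := smear_three v hv Φ τ 1 hτ one_pos
    calc groundStateEnergy v 0 (L₀ + 2 * τ + 2 * τ + 2 * τ) ≤ energy v Θ :=
          groundStateEnergy_le_energy v Θ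
      _ = 0 := energy_eq_zero_of_zero v Θ
      _ ≤ _ := zero_le
  have hN0 : (N : ℝ≥0∞) ≠ 0 := by exact_mod_cast hN.ne'
  have hNtop : (N : ℝ≥0∞) ≠ ⊤ := ENNReal.natCast_ne_top N
  have hNpos : (0 : ℝ) < N := by exact_mod_cast hN
  refine ENNReal.le_of_forall_pos_le_add fun s' hs' _ => ?_
  -- inner slack `s := s'/9`
  have hs : (0 : ℝ) < (s' : ℝ) / 9 := by positivity
  obtain ⟨Θ, hr, hR⟩ := smear_three v hv Φ τ ((s' : ℝ) / 9) hτ hs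
  have key := sum_lintegral_sq_fderiv_rigid_add v Θ
  -- `N · energy Θ ≤ 3 P + 3 S + N (relE Φ + 3 S)`
  have hNE : (N : ℝ≥0∞) * energy v Θ ≤
      3 * ENNReal.ofReal (Real.pi ^ 2 / (4 * τ ^ 2) + (s' : ℝ) / 9) +
        3 * ENNReal.ofReal ((s' : ℝ) / 9) +
        (N : ℝ≥0∞) * (relEnergy v Φ + 3 * ENNReal.ofReal ((s' : ℝ) / 9)) := by
    rw [← key]
    exact add_le_add hR (by gcongr)
  -- divide by `N`
  have hE : energy v Θ ≤
      (N : ℝ≥0∞)⁻¹ * (3 * ENNReal.ofReal (Real.pi ^ 2 / (4 * τ ^ 2) + (s' : ℝ) / 9) +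
        3 * ENNReal.ofReal ((s' : ℝ) / 9)) +
        (relEnergy v Φ + 3 * ENNReal.ofReal ((s' : ℝ) / 9)) := by
    have h1 : energy v Θ = (N : ℝ≥0∞)⁻¹ * ((N : ℝ≥0∞) * energy v Θ) := by
      rw [← mul_assoc, ENNReal.inv_mul_cancel hN0 hNtop, one_mul]
    rw [h1]
    calc (N : ℝ≥0∞)⁻¹ * ((N : ℝ≥0∞) * energy v Θ)
        ≤ (N : ℝ≥0∞)⁻¹ * (3 * ENNReal.ofReal (Real.pi ^ 2 / (4 * τ ^ 2) + (s' : ℝ) / 9) +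
            3 * ENNReal.ofReal ((s' : ℝ) / 9) +
            (N : ℝ≥0∞) * (relEnergy v Φ + 3 * ENNReal.ofReal ((s' : ℝ) / 9))) := by gcongr
      _ = _ := by
          rw [mul_add, ← mul_assoc _ (N : ℝ≥0∞), ENNReal.inv_mul_cancel hN0 hNtop, one_mul]
  -- bookkeeping of the slack: everything except `relE Φ + ofReal (3π²/(4Nτ²))` is `≤ s'`
  have hsmall : (N : ℝ≥0∞)⁻¹ * (3 * ENNReal.ofReal (Real.pi ^ 2 / (4 * τ ^ 2) + (s' : ℝ) / 9) +
        3 * ENNReal.ofReal ((s' : ℝ) / 9)) + 3 * ENNReal.ofReal ((s' : ℝ) / 9) ≤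
      ENNReal.ofReal (3 * Real.pi ^ 2 / (4 * N * τ ^ 2)) + s' := by
    have hpi : (0 : ℝ) ≤ Real.pi ^ 2 / (4 * τ ^ 2) := by positivity
    have hs9 : (0 : ℝ) ≤ (s' : ℝ) / 9 := hs.le
    -- rewrite everything as `ofReal` of real numbers
    have hinv : (N : ℝ≥0∞)⁻¹ = ENNReal.ofReal ((N : ℝ)⁻¹) := by
      rw [ENNReal.ofReal_inv_of_pos hNpos, ENNReal.ofReal_natCast]
    have h3 : (3 : ℝ≥0∞) = ENNReal.ofReal 3 := by norm_num
    rw [hinv, h3, ← ENNReal.ofReal_mul (by norm_num), ← ENNReal.ofReal_mul (by norm_num),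
      ← ENNReal.ofReal_add (by positivity) (by positivity), ← ENNReal.ofReal_mul (by positivity),
      ← ENNReal.ofReal_add (by positivity) (by positivity), ← ENNReal.ofReal_coe_nnreal,
      ← ENNReal.ofReal_add (by positivity) NNReal.zero_le_coe]
    refine ENNReal.ofReal_le_ofReal ?_
    have hNinv : (N : ℝ)⁻¹ ≤ 1 := by
      rw [inv_le_one_iff₀]; right; exact_mod_cast hN
    have hNinv0 : (0 : ℝ) ≤ (N : ℝ)⁻¹ := by positivity
    have hexp : (N : ℝ)⁻¹ * (3 * (Real.pi ^ 2 / (4 * τ ^ 2) + (s' : ℝ) / 9) + 3 * ((s' : ℝ) / 9)) +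
        3 * ((s' : ℝ) / 9) =
        3 * Real.pi ^ 2 / (4 * N * τ ^ 2) + ((N : ℝ)⁻¹ * (6 * ((s' : ℝ) / 9)) + 3 * ((s' : ℝ) / 9)) := by
      field_simp
      ring
    rw [hexp]
    have : (N : ℝ)⁻¹ * (6 * ((s' : ℝ) / 9)) ≤ 1 * (6 * ((s' : ℝ) / 9)) :=
      mul_le_mul_of_nonneg_right hNinv (by positivity)
    nlinarith [this]
  calc groundStateEnergy v N (L₀ + 2 * τ + 2 * τ + 2 * τ) ≤ energy v Θ := groundStateEnergy_le_energy v Θ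
    _ ≤ _ := hE
    _ = relEnergy v Φ + ((N : ℝ≥0∞)⁻¹ * (3 * ENNReal.ofReal (Real.pi ^ 2 / (4 * τ ^ 2) + (s' : ℝ) / 9) +
        3 * ENNReal.ofReal ((s' : ℝ) / 9)) + 3 * ENNReal.ofReal ((s' : ℝ) / 9)) := by ring
    _ ≤ relEnergy v Φ + (ENNReal.ofReal (3 * Real.pi ^ 2 / (4 * N * τ ^ 2)) + s') := by gcongr
    _ = relEnergy v Φ + ENNReal.ofReal (3 * Real.pi ^ 2 / (4 * N * τ ^ 2)) + s' := by rw [add_assoc]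

/-! ## The crux from displacement softness -/

/-- **`RigidMomentumBound` from displacement softness** (the registered open stub
`stub_displacementSoftness` of the line, taken here as the hypothesis `hS4`): together with the LANDED
inputs `stub_dirichletEnergyLinear` (finiteness) and `smearingBound` it implies the crux.
For admissible `v`: `ρ₀ := min ρ₁ ρ₄`; at `0 < ρ < ρ₀` and `ε > 0` put `κ := 6π√(3/ε)` (so
`κ² = 108π²/ε`); eventually in `N` (`N ≥ 1`, S1: `E₀(N,L_N) ≤ CN`, S4 at `(ε/4, κ)`):
with `τ := κL_N/(6N)` one has `L_N + 6τ = (1+κ/N)L_N` and `3π²/(4Nτ²) = εN/(4L_N²)`, so S4 and the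
smearing bound give `E₀(N,L_N) ≤ E₀^rel(N,L_N) + εN/(4L²) + εN/(4L²)`; with `δ := ofReal(εN/(4L²)) > 0` a
`δ`-near-minimiser `Ψ` has finite energy `≤ E₀^rel + 3·ofReal(εN/(4L²))`, hence
`⟨Ψ,P²Ψ⟩ ≤ N · 3εN/(4L²) ≤ εN²/L²` by the reduction lemma (König's identity). -/
theorem rigidMomentumBound_of_displacementSoftness
    (hS4 : ∀ v : ℝ → ℝ≥0∞, IsRepulsiveFiniteRange v → ∃ ρ₀ : ℝ, 0 < ρ₀ ∧ ∀ ρ : ℝ, 0 < ρ → ρ < ρ₀ →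
      ∀ ε : ℝ, 0 < ε → ∀ κ : ℝ, 0 < κ → ∀ᶠ N : ℕ in atTop,
        groundStateEnergy v N (sideLength ρ N) ≤
          groundStateEnergy v N ((1 + κ / N) * sideLength ρ N) +
            ENNReal.ofReal (ε * N / sideLength ρ N ^ 2)) :
    Summit.AtomisticToContinuum.BoseEinsteinCondensation.Theses.BECTangentRigidity.RigidMomentumBound := by
  intro v hv
  obtain ⟨ρ₁, hρ₁, h₁⟩ := RigidMomentumBound.stub_dirichletEnergyLinear v hv
  obtain ⟨ρ₄, hρ₄, h₄⟩ := hS4 v hv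
  refine ⟨min ρ₁ ρ₄, lt_min hρ₁ hρ₄, fun ρ hρ hρlt ε hε => ?_⟩
  obtain ⟨C, _, hE₀⟩ := h₁ ρ hρ (hρlt.trans_le (min_le_left _ _))
  set κ : ℝ := 6 * Real.pi * Real.sqrt (3 / ε) with hκ
  have hκpos : 0 < κ := by positivity
  have hS := h₄ ρ hρ (hρlt.trans_le (min_le_right _ _)) (ε / 4) (by positivity) κ hκpos
  filter_upwards [hE₀, hS, eventually_gt_atTop 0] with N hN₁ hN₄ hN0
  have hNpos : (0 : ℝ) < N := Nat.cast_pos.2 hN0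
  have hLpos : 0 < sideLength ρ N := Real.rpow_pos_of_pos (div_pos hNpos hρ) _
  set L := sideLength ρ N with hLdef
  set η : ℝ≥0∞ := ENNReal.ofReal (ε / 4 * N / L ^ 2) with hη
  have hηpos : 0 < η := ENNReal.ofReal_pos.2 (by positivity)
  refine ⟨η, hηpos, fun Ψ hΨ => ?_⟩
  -- the smearing bound at `τ := κ L /(6 N)`
  set τ : ℝ := κ * L / (6 * N) with hτdef
  have hτ : 0 < τ := by positivity
  have hsm := smearingBound v hv.1 N L τ hτ
  have hL6 : L + 6 * τ = (1 + κ / N) * L := by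
    rw [hτdef]; field_simp
  have hsq : Real.sqrt (3 / ε) ^ 2 = 3 / ε := Real.sq_sqrt (by positivity)
  have hconst : 3 * Real.pi ^ 2 / (4 * N * τ ^ 2) = ε / 4 * N / L ^ 2 := by
    rw [hτdef, hκ]
    field_simp
    rw [hsq]
    field_simp
  rw [hL6, hconst, ← hη] at hsm
  -- `E₀(L) ≤ E₀^rel(L) + η + η`
  have hE₀rel : groundStateEnergy v N L ≤ relGroundStateEnergy v N L + (η + η) :=
    calc groundStateEnergy v N L ≤ groundStateEnergy v N ((1 + κ / N) * L) + η := hN₄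
      _ ≤ relGroundStateEnergy v N L + η + η := by gcongr
      _ = _ := by rw [add_assoc]
  -- finiteness of the energy of the near-minimiser (from S1)
  have hEfin : energy v Ψ ≠ ⊤ :=
    ne_top_of_le_ne_top (ENNReal.add_ne_top.2 ⟨ENNReal.ofReal_ne_top, ENNReal.ofReal_ne_top⟩)
      (hΨ.trans (add_le_add hN₁ le_rfl))
  have h3 : energy v Ψ ≤ relGroundStateEnergy v N L + (η + η + η) :=
    calc energy v Ψ ≤ groundStateEnergy v N L + η := hΨ
      _ ≤ relGroundStateEnergy v N L + (η + η) + η := by gcongr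
      _ = _ := by rw [add_assoc]
  calc ∑ a : Fin 3, ∫⁻ X,
          (‖fderiv ℝ Ψ.ψ X (fun _ : Fin N => EuclideanSpace.single a (1 : ℝ))‖₊ : ℝ≥0∞) ^ 2
        ≤ (N : ℝ≥0∞) * (η + η + η) := sum_lintegral_sq_fderiv_rigid_le_of_energy_le v Ψ hEfin h3
    _ = ENNReal.ofReal (3 * ε / 4 * (N : ℝ) ^ 2 / L ^ 2) := by
          rw [hη, ← ENNReal.ofReal_add (by positivity) (by positivity),
            ← ENNReal.ofReal_add (by positivity) (by positivity), ← ENNReal.ofReal_natCast,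
            ← ENNReal.ofReal_mul hNpos.le]
          congr 1
          field_simp
          ring
    _ ≤ ENNReal.ofReal (ε * (N : ℝ) ^ 2 / L ^ 2) := by
          refine ENNReal.ofReal_le_ofReal ?_
          rw [div_le_div_iff_of_pos_right (by positivity)]
          nlinarith [sq_nonneg (N : ℝ), hε, mul_nonneg hε.le (sq_nonneg (N : ℝ))]


end Smearing

end Summit.AtomisticToContinuum.BoseEinsteinCondensation.Theorems.RigidMomentumBound

end
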